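import Mathlib.AlgebraicGeometry.Morphisms.Separated
import Mathlib.AlgebraicGeometry.Morphisms.ClosedImmersion
import Mathlib.AlgebraicGeometry.IdealSheaf.Functorial
import Mathlib.CategoryTheory.Limits.Preserves.Shapes.Equalizers
import HarnessLib

/-!
# «`f = g`» as a condition on the base: the equaliser of two `S`-morphisms and base change

Topic `Literature/AlgebraicGeometry/Morphisms`; theorems only (no definition, no named fact, no
instance, no `sorry`).  Cell hodgecm-mathlib, F-DAG second wave (h6-c) (the «`f = g` is a closed
condition» corollary of the (h6) containment locus; design of record
`B-provers/B-p16/g14/H6-DESIGN.B-p16g14.md`).  HC_CM is proved only modulo the 7 printed citations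
until rung 0 closes; nothing here changes that.

For `S`-schemes `X Y : Over S` and two `S`-morphisms `f g : X ⟶ Y`, the equaliser
`Eq(f,g) := equalizer f g` (taken in `Over S`) is a subscheme `(equalizer.ι f g).left : Eq(f,g) ⟶ X`
of `X`, CLOSED when `Y ⟶ S` is separated ([GortzWedhorn2020] Definition/Proposition 9.7 (ii); Mathlib
`isClosedImmersion_equalizer_ι_left`, [Stacks 01KM]).  Its functor of points is
«`h : W ⟶ X` factors through `Eq(f,g)` iff `h ≫ f = h ≫ g`» ([GortzWedhorn2020] Definition 9.1 (3));
for a CLOSED immersion `e` this is the ideal-sheaf condition `𝓘_{Eq(f,g)} = e.ker ≤ h.ker` (Mathlib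
`IsClosedImmersion.lift`).  Along a base change `b : T ⟶ S` (Mathlib `Over.pullback b`, the functor
`X ↦ X ×_S T`), the base-changed morphisms `f_T, g_T` agree iff the projection
`pr : X ×_S T ⟶ X` equalises `f, g`, iff `pr` factors through `Eq(f,g)`, iff `e.ker ≤ pr.ker`
(«`X_T ⊆ Eq(f,g)_T`»), and `Eq(f,g)_T ≅ Eq(f_T,g_T)` (equalisers commute with base change: a right
adjoint preserves limits).  Consequently the subfunctor «`f_T = g_T`» of `S` is the CONTAINMENT
functor «`X_T ⊆ Z_T`» for the closed subscheme `Z := Eq(f,g)` of `X`: whenever the latter is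
represented by a closed subscheme of `S` (for `X ⟶ S` projective and flat: (h6-b), cohomology and
base change; for `X ⟶ S` proper flat of finite presentation: purity, not in the tree), so is the
former — `le_ker_iff_pullback_map_eq_of_containment` records this transfer against the
representability statement as a NAMED HYPOTHESIS, so that this file does not depend on (h6-b).

* §1 `exists_comp_equalizer_ι_eq_iff` (functor of points of `Eq(f,g)`),
  `ker_equalizer_ι_le_of_comp_eq_comp`, `comp_eq_comp_iff_ker_equalizer_ι_le` (ideal form, `Y/S`
  separated);
* §2 `pullback_map_eq_iff_fst_comp_eq`, `pullback_map_eq_iff_exists_comp_equalizer_ι`,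
  `pullback_map_eq_iff_ker_equalizer_ι_le` («`f_T = g_T` iff `X_T ⊆ Eq(f,g)_T`»),
  `pullback_map_eq_comp_of_pullback_map_eq` (subfunctor), `nonempty_pullback_equalizer_iso` and
  `preservesEqualizerIso_hom_comp_ι` (`Eq(f,g)_T ≅ Eq(f_T, g_T)` compatibly with the immersions);
* §3 `le_ker_iff_pullback_map_eq_of_containment`,
  `exists_comp_subschemeι_eq_iff_pullback_map_eq_of_containment` (closedness of «`f = g`» from
  closedness of containment, hypothesis `hJ`).

## References
* [GortzWedhorn2020] U. Görtz, T. Wedhorn, *Algebraic Geometry I: Schemes*, 2nd ed. (2020):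
  Section (9.1) «Diagonals, graphs, and equalizers in arbitrary categories», Definition 9.1 (3)
  (p. 231: the equalizer `Eq(f,g)` of two `S`-morphisms and the functor it represents),
  Proposition 9.3 (the equalizer as a base change of the diagonal), Definition/Proposition 9.7 (ii)
  (`Y ⟶ S` separated iff every `Eq(f,g) ⊆ X` is a closed subscheme), Section (4.7) (pp. 107–108:
  base change `X ×_S S'`, `f ×_S id_{S'}` as a functor on `S`-objects).
* [StacksProject] Tag 01KM (the equalizer of two morphisms over `S` into a scheme separated over
  `S` is a closed subscheme; Mathlib `isClosedImmersion_equalizer_ι_left`).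
-/

noncomputable section

open CategoryTheory CategoryTheory.Limits AlgebraicGeometry

universe u

namespace Literature.AlgebraicGeometry.Morphisms

variable {S : Scheme.{u}} {X Y : Over S} (f g : X ⟶ Y)

/-! ## §1 The functor of points of the equaliser `Eq(f,g) ⊆ X` -/

/-- **Functor of points of the equaliser.** A morphism `h : W ⟶ X` (of schemes; `W` becomes an
`S`-scheme via `h ≫ (X ⟶ S)`) factors through `Eq(f,g) ⟶ X` iff `h ≫ f = h ≫ g`.
[cite: GortzWedhorn2020, Definition 9.1 (3) (p. 231) and Proposition 9.3] -/
theorem exists_comp_equalizer_ι_eq_iff {W : Scheme.{u}} (h : W ⟶ X.left) :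
    (∃ l : W ⟶ (equalizer f g).left, l ≫ (equalizer.ι f g).left = h) ↔
      h ≫ f.left = h ≫ g.left := by
  constructor
  · rintro ⟨l, rfl⟩
    rw [Category.assoc, Category.assoc, ← Over.comp_left, ← Over.comp_left, equalizer.condition]
  · intro hfg
    let W' : Over S := Over.mk (h ≫ X.hom)
    let h' : W' ⟶ X := Over.homMk h rfl
    have hfg' : h' ≫ f = h' ≫ g := Over.OverMorphism.ext hfg
    exact ⟨(equalizer.lift h' hfg').left, congrArg Over.Hom.left (equalizer.lift_ι h' hfg')⟩

/-- If `h ≫ f = h ≫ g` then the ideal sheaf of `Eq(f,g) ⟶ X` is contained in that of `h`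
(`h` factors through the equaliser; Mathlib `Scheme.Hom.le_ker_comp`). No separatedness is needed
for this direction. [cite: GortzWedhorn2020, Definition 9.1 (3) (p. 231) and Proposition 9.3] -/
theorem ker_equalizer_ι_le_of_comp_eq_comp {W : Scheme.{u}} {h : W ⟶ X.left}
    (hfg : h ≫ f.left = h ≫ g.left) : (equalizer.ι f g).left.ker ≤ h.ker := by
  obtain ⟨l, rfl⟩ := (exists_comp_equalizer_ι_eq_iff f g h).2 hfg
  exact Scheme.Hom.le_ker_comp _ _

/-- **Ideal-sheaf form of the functor of points, `Y ⟶ S` separated.** Then `Eq(f,g) ⟶ X` is a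
closed immersion (Mathlib `isClosedImmersion_equalizer_ι_left`), and `h ≫ f = h ≫ g` iff the ideal
sheaf `𝓘_{Eq(f,g)}` dies under `h`, i.e. `(equalizer.ι f g).left.ker ≤ h.ker` (Mathlib
`IsClosedImmersion.lift`). [cite: GortzWedhorn2020, Definition/Proposition 9.7 (ii)]
[cite: StacksProject, Tag 01KM] -/
theorem comp_eq_comp_iff_ker_equalizer_ι_le [IsSeparated Y.hom] {W : Scheme.{u}}
    (h : W ⟶ X.left) :
    h ≫ f.left = h ≫ g.left ↔ (equalizer.ι f g).left.ker ≤ h.ker := by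
  refine ⟨ker_equalizer_ι_le_of_comp_eq_comp f g, fun H => ?_⟩
  rw [← exists_comp_equalizer_ι_eq_iff]
  exact ⟨IsClosedImmersion.lift (equalizer.ι f g).left h H, IsClosedImmersion.lift_fac _ _ _⟩

/-! ## §2 Base change along `b : T ⟶ S`

`Over.pullback b : Over S ⥤ Over T` is Mathlib's base-change functor: `(Over.pullback b).obj X`
is `X ×_S T := pullback (X ⟶ S) b` over `T` by `pullback.snd`, with projection
`pullback.fst X.hom b : X ×_S T ⟶ X`, and `(Over.pullback b).map f = f ×_S T =: f_T`. -/

variable {T : Scheme.{u}} (b : T ⟶ S)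

/-- **`f_T = g_T` iff `f, g` agree after composition with the projection `X ×_S T ⟶ X`.**
[cite: GortzWedhorn2020, Section (4.7) (pp. 107–108) and Proposition 9.3] -/
theorem pullback_map_eq_iff_fst_comp_eq :
    (Over.pullback b).map f = (Over.pullback b).map g ↔
      pullback.fst X.hom b ≫ f.left = pullback.fst X.hom b ≫ g.left := by
  constructor
  · intro hfg
    -- the two lifts `X ×_S T ⟶ Y ×_S T` agree; compose with the projection to `Y`
    have h1 : (pullback.lift (pullback.fst X.hom b ≫ f.left) (pullback.snd X.hom b)
          (by simp [pullback.condition]) : pullback X.hom b ⟶ pullback Y.hom b) =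
        pullback.lift (pullback.fst X.hom b ≫ g.left) (pullback.snd X.hom b)
          (by simp [pullback.condition]) := by
      have := congrArg Over.Hom.left hfg
      simp only [Over.pullback_map_left] at this
      exact this
    have h2 := congrArg (· ≫ pullback.fst Y.hom b) h1
    simpa only [pullback.lift_fst] using h2
  · intro hfg
    ext1
    simp only [Over.pullback_map_left]
    apply pullback.hom_ext
    · simp only [pullback.lift_fst, hfg]
    · simp only [pullback.lift_snd]

/-- **`f_T = g_T` iff the projection `X ×_S T ⟶ X` factors through the equaliser `Eq(f,g)`**
(«`X_T ⊆ Eq(f,g)_T`», factorisation form).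
[cite: GortzWedhorn2020, Definition 9.1 (3) (p. 231) and Proposition 9.3] -/
theorem pullback_map_eq_iff_exists_comp_equalizer_ι :
    (Over.pullback b).map f = (Over.pullback b).map g ↔
      ∃ l : pullback X.hom b ⟶ (equalizer f g).left,
        l ≫ (equalizer.ι f g).left = pullback.fst X.hom b := by
  rw [pullback_map_eq_iff_fst_comp_eq, exists_comp_equalizer_ι_eq_iff]

/-- **`f_T = g_T` iff `X_T ⊆ Eq(f,g)_T` scheme-theoretically** (ideal-sheaf form, `Y ⟶ S`
separated): the ideal sheaf of the closed subscheme `Eq(f,g) ⊆ X` dies under the projection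
`X ×_S T ⟶ X`. This is the containment functor of (h6) at `Z := Eq(f,g)`.
[cite: GortzWedhorn2020, Definition/Proposition 9.7 (ii)] [cite: StacksProject, Tag 01KM] -/
theorem pullback_map_eq_iff_ker_equalizer_ι_le [IsSeparated Y.hom] :
    (Over.pullback b).map f = (Over.pullback b).map g ↔
      (equalizer.ι f g).left.ker ≤ (pullback.fst X.hom b).ker := by
  rw [pullback_map_eq_iff_fst_comp_eq, comp_eq_comp_iff_ker_equalizer_ι_le]

/-- **«`f_T = g_T`» is a subfunctor of `S`**: if `f, g` agree after base change along
`b : T ⟶ S`, they agree after base change along `c ≫ b` for every `c : T' ⟶ T` (the projection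
`X ×_S T' ⟶ X` factors through `X ×_S T ⟶ X`).
[cite: GortzWedhorn2020, Section (4.7) (pp. 107–108)] -/
theorem pullback_map_eq_comp_of_pullback_map_eq {T' : Scheme.{u}} (c : T' ⟶ T)
    (hb : (Over.pullback b).map f = (Over.pullback b).map g) :
    (Over.pullback (c ≫ b)).map f = (Over.pullback (c ≫ b)).map g := by
  rw [pullback_map_eq_iff_fst_comp_eq] at hb ⊢
  have hfst : pullback.fst X.hom (c ≫ b) =
      pullback.lift (pullback.fst X.hom (c ≫ b)) (pullback.snd X.hom (c ≫ b) ≫ c)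
          (by rw [pullback.condition, Category.assoc]) ≫ pullback.fst X.hom b :=
    (pullback.lift_fst _ _ _).symm
  rw [hfst]
  simp only [Category.assoc, hb]

/-- **Equalisers commute with base change**: `Eq(f,g) ×_S T ≅ Eq(f_T, g_T)` over `T`
(`Over.pullback b` is a right adjoint — Mathlib `Over.mapPullbackAdj` — hence preserves limits;
Mathlib `PreservesEqualizer.iso`).
[cite: GortzWedhorn2020, Section (4.7) (pp. 107–108) and Proposition 9.3] -/
theorem nonempty_pullback_equalizer_iso :
    Nonempty ((Over.pullback b).obj (equalizer f g) ≅
      equalizer ((Over.pullback b).map f) ((Over.pullback b).map g)) :=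
  ⟨PreservesEqualizer.iso (Over.pullback b) f g⟩

/-- The comparison isomorphism `Eq(f,g) ×_S T ≅ Eq(f_T, g_T)` is compatible with the two closed
immersions into `X ×_S T`: composing it with `Eq(f_T,g_T) ⟶ X_T` gives `(Eq(f,g) ⟶ X) ×_S T`.
[cite: GortzWedhorn2020, Section (4.7) (pp. 107–108) and Proposition 9.3] -/
theorem preservesEqualizerIso_hom_comp_ι :
    (PreservesEqualizer.iso (Over.pullback b) f g).hom ≫
        equalizer.ι ((Over.pullback b).map f) ((Over.pullback b).map g) =
      (Over.pullback b).map (equalizer.ι f g) := by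
  simp only [PreservesEqualizer.iso_hom, equalizerComparison_comp_π]

/-! ## §3 Closedness of «`f = g`» from closedness of containment

The subfunctor «`f_T = g_T`» of `S` coincides with the containment functor «`X_T ⊆ Z_T`» for
`Z := Eq(f,g)` (§2).  If the latter is represented by the closed subscheme of `S` with ideal sheaf
`J` — hypothesis `hJ`, the output of (h6-b) for `X ⟶ S` projective and flat — then so is the
former: a morphism `b : T ⟶ S` factors through `V(J) ⊆ S` (`J ≤ b.ker`) iff `f_T = g_T`. -/

/-- **«`f = g`» is a closed condition, given that containment in `Eq(f,g)` is one** (transfer of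
representability; `J` = the ideal sheaf of the closed locus, `hJ` = its universal property for the
closed subscheme `Eq(f,g) ⊆ X`).
[cite: GortzWedhorn2020, Definition/Proposition 9.7 (ii) and Section (4.7) (pp. 107–108)] -/
theorem le_ker_iff_pullback_map_eq_of_containment [IsSeparated Y.hom]
    (J : S.IdealSheafData)
    (hJ : ∀ ⦃T : Scheme.{u}⦄ (b : T ⟶ S),
      J ≤ b.ker ↔ (equalizer.ι f g).left.ker ≤ (pullback.fst X.hom b).ker) :
    ∀ ⦃T : Scheme.{u}⦄ (b : T ⟶ S),
      J ≤ b.ker ↔ (Over.pullback b).map f = (Over.pullback b).map g :=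
  fun _ b => (hJ b).trans (pullback_map_eq_iff_ker_equalizer_ι_le f g b).symm

/-- Factorisation form of `le_ker_iff_pullback_map_eq_of_containment`: `b : T ⟶ S` factors
through the closed subscheme
`V(J) ⟶ S` iff `f_T = g_T` (Mathlib `IsClosedImmersion.lift` for `J.subschemeι`).
[cite: GortzWedhorn2020, Definition/Proposition 9.7 (ii) and Section (4.7) (pp. 107–108)] -/
theorem exists_comp_subschemeι_eq_iff_pullback_map_eq_of_containment [IsSeparated Y.hom]
    (J : S.IdealSheafData)
    (hJ : ∀ ⦃T : Scheme.{u}⦄ (b : T ⟶ S),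
      J ≤ b.ker ↔ (equalizer.ι f g).left.ker ≤ (pullback.fst X.hom b).ker)
    {T : Scheme.{u}} (b : T ⟶ S) :
    (∃ b' : T ⟶ J.subscheme, b' ≫ J.subschemeι = b) ↔
      (Over.pullback b).map f = (Over.pullback b).map g := by
  rw [← le_ker_iff_pullback_map_eq_of_containment f g J hJ b]
  constructor
  · rintro ⟨b', rfl⟩
    exact J.ker_subschemeι.symm.trans_le (Scheme.Hom.le_ker_comp _ _)
  · intro H
    exact ⟨IsClosedImmersion.lift J.subschemeι b (by rwa [J.ker_subschemeι]),
      IsClosedImmersion.lift_fac _ _ _⟩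

end Literature.AlgebraicGeometry.Morphisms
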